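import Mathlib
import HarnessLib
import Summits.HubbardSuperconductivity.HubbardSuperconductivity.Theorems.KLProgrammeKLRegimeVolumeLimitSecondOrderWick

/-!
# Child `KLRegimeVolumeLimit` (stmt-HubbardSuperconductivity-19665 / its gen-3 twin) — the ORDER-`U²` RUNG of the volume-limit
# carrier, Wick evaluation II: the six-point function `∫ ∂⁺_{k↑}W · ∂⁻_{k↑}W` (spin-`↑` external legs) (seat hubbard-kl-k3c5-p3)

With `W = (βL²)⁻³ Σ_{k₁+k₃=k₂+k₄} ψ̂⁺_{k₁↑}ψ̂⁻_{k₂↑}ψ̂⁺_{k₃↓}ψ̂⁻_{k₄↓}`: `∂⁺_{k↑}W = (βL²)⁻³ Σ_{k+k₃=k₂+k₄} ψ̂⁻_{k₂↑}ψ̂⁺_{k₃↓}ψ̂⁻_{k₄↓}` and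
`∂⁻_{k↑}W = −(βL²)⁻³ Σ_{k₁+k₃=k+k₄} ψ̂⁺_{k₁↑}ψ̂⁺_{k₃↓}ψ̂⁻_{k₄↓}`; the Gaussian integral of the product is a six-point function, computed
by ONE integration by parts on `ψ̂⁻_{k₂↑}` (its only partner is `ψ̂⁺_{k₁'↑}`) and the spin-`↓` four-point function (two pairings:
direct = two separate loops, exchange = one loop through both vertices).  Summing the vertex constraints:

  `∫ ∂⁺_{k↑}W · ∂⁻_{k↑}W = (βL²)⁻⁶ (βL²)³ (Sun(k) − ĝ(k) T²)`,  `Sun(k) = Σ_{k+k₃=k₂+k₄} ĝ(k₂)ĝ(k₃)ĝ(k₄)`,  `T = Σ_q ĝ(q)`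

(`gaussExpect_dPlus_mul_dMinus_up`) — the SUNSET (exchange) and the one-particle-REDUCIBLE double tadpole (direct); exact frequency
(`2M` kept labels) and torus-momentum conservation.  Valid for every seedless frame covariance `C^K`.  The spin-`↓` twin is
`…SecondOrderSunsetDown`.  Everything is proved; no definition.
-/

noncomputable section

namespace Summit.HubbardSuperconductivity.HubbardSuperconductivity.Theorems.TwoPointAssembly

set_option linter.dupNamespace false -- summit = problem name (single-conjunct summit), D-0017

open Finset Filter Topology Literature.MathematicalPhysics.QuantumLattice Literature.Probability.LatticeModels GrassmannAlgebra
open Summit.HubbardSuperconductivity.HubbardSuperconductivity.Theorems.KLRegimeSplit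
open Summit.HubbardSuperconductivity.HubbardSuperconductivity.Theorems.KLProgrammeLegKernels

variable {L M : ℕ} [NeZero L]

/-! ## The six-point function, spin `↑` external legs -/

omit [NeZero L] in
/-- `∂_{ψ̂⁺_{k↑}} (ψ̂⁺_{k₁↑}ψ̂⁻_{k₂↑}ψ̂⁺_{k₃↓}ψ̂⁻_{k₄↓}) = [k₁ = k] ψ̂⁻_{k₂↑}ψ̂⁺_{k₃↓}ψ̂⁻_{k₄↓}`. -/
theorem grassmannDeriv_psiPlus_up_vertexMonomial (k k₁ k₂ k₃ k₄ : FreqMomentum L M) :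
    grassmannDeriv ℂ (((k, 0), 0) : HubbardFieldIdx L M) (psiPlus k₁ 0 * psiMinus k₂ 0 * psiPlus k₃ 1 * psiMinus k₄ 1) =
      if k₁ = k then psiMinus k₂ 0 * (psiPlus k₃ 1 * psiMinus k₄ 1) else 0 := by
  simp only [psiPlus, psiMinus, mul_assoc, grassmannDeriv_gen_mul, grassmannDeriv_gen]
  by_cases h : k₁ = k
  · subst h; simp
  · simp [h, Ne.symm h]

/-- **`∂⁺_{k↑} W = (βL²)⁻³ Σ_{k+k₃=k₂+k₄} ψ̂⁻_{k₂↑}ψ̂⁺_{k₃↓}ψ̂⁻_{k₄↓}`.** -/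
theorem dPlus_up_hubbardInteraction (β : ℝ) (k : FreqMomentum L M) :
    grassmannDeriv ℂ (((k, 0), 0) : HubbardFieldIdx L M) (hubbardInteraction L M β 1) =
      (((1 / (β * (L : ℝ) ^ 2) ^ 3 : ℝ) : ℂ)) • ∑ k₂ : FreqMomentum L M, ∑ k₃ : FreqMomentum L M, ∑ k₄ : FreqMomentum L M,
        if matsubaraInt M k.1 + matsubaraInt M k₃.1 = matsubaraInt M k₂.1 + matsubaraInt M k₄.1 ∧ k.2 + k₃.2 = k₂.2 + k₄.2 then
          psiMinus k₂ 0 * (psiPlus k₃ 1 * psiMinus k₄ 1) else 0 := by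
  rw [hubbardInteraction]
  simp only [map_smul, map_sum, grassmannDeriv_ite, grassmannDeriv_psiPlus_up_vertexMonomial]
  congr 1
  rw [Finset.sum_eq_single k]
  · simp only [if_true]
  · intro k₁ _ h; simp [h]
  · intro h; exact absurd (Finset.mem_univ _) h

/-- **`∂⁻_{k↑} W = (βL²)⁻³ Σ_{k₁+k₃=k+k₄} (−ψ̂⁺_{k₁↑}ψ̂⁺_{k₃↓}ψ̂⁻_{k₄↓})`.** -/
theorem dMinus_up_hubbardInteraction (β : ℝ) (k : FreqMomentum L M) :
    grassmannDeriv ℂ (((k, 0), 1) : HubbardFieldIdx L M) (hubbardInteraction L M β 1) =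
      (((1 / (β * (L : ℝ) ^ 2) ^ 3 : ℝ) : ℂ)) • ∑ k₁ : FreqMomentum L M, ∑ k₃ : FreqMomentum L M, ∑ k₄ : FreqMomentum L M,
        if matsubaraInt M k₁.1 + matsubaraInt M k₃.1 = matsubaraInt M k.1 + matsubaraInt M k₄.1 ∧ k₁.2 + k₃.2 = k.2 + k₄.2 then
          -(psiPlus k₁ 0 * (psiPlus k₃ 1 * psiMinus k₄ 1)) else 0 := by
  rw [hubbardInteraction]
  simp only [map_smul, map_sum, grassmannDeriv_ite, grassmannDeriv_psiMinus_up_vertexMonomial]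
  congr 1
  refine Finset.sum_congr rfl fun k₁ _ => ?_
  rw [Finset.sum_eq_single k]
  · simp only [if_true]
  · intro k₂ _ h
    exact Finset.sum_eq_zero fun k₃ _ => Finset.sum_eq_zero fun k₄ _ => by simp [h]
  · intro h; exact absurd (Finset.mem_univ _) h

omit [NeZero L] in
/-- The inner derivative of the six-point monomial (spin `↑` case): only `ψ̂⁺_{k₁'↑}` responds to `∂_{ψ̂⁺_{k₂↑}}`. -/
theorem grassmannDeriv_sixPoint_up (k₂ k₃ k₄ k₁' k₃' k₄' : FreqMomentum L M) :
    grassmannDeriv ℂ (((k₂, 0), 0) : HubbardFieldIdx L M)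
        (gen ℂ (((k₃, 1), 0) : HubbardFieldIdx L M) * (gen ℂ (((k₄, 1), 1) : HubbardFieldIdx L M) *
          (gen ℂ (((k₁', 0), 0) : HubbardFieldIdx L M) * (gen ℂ (((k₃', 1), 0) : HubbardFieldIdx L M) *
            gen ℂ (((k₄', 1), 1) : HubbardFieldIdx L M))))) =
      if k₁' = k₂ then
        gen ℂ (((k₃, 1), 0) : HubbardFieldIdx L M) * (gen ℂ (((k₄, 1), 1) : HubbardFieldIdx L M) *
          (gen ℂ (((k₃', 1), 0) : HubbardFieldIdx L M) * gen ℂ (((k₄', 1), 1) : HubbardFieldIdx L M)))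
      else 0 := by
  simp only [grassmannDeriv_gen_mul, grassmannDeriv_gen]
  by_cases h : k₁' = k₂
  · subst h; simp
  · simp [h, Ne.symm h]

omit [NeZero L] in
/-- The inner derivative of the four-point monomial (all spin `↓`). -/
theorem grassmannDeriv_fourPoint_down (k₃ k₄ k₃' k₄' : FreqMomentum L M) :
    grassmannDeriv ℂ (((k₃, 1), 1) : HubbardFieldIdx L M)
        (gen ℂ (((k₄, 1), 1) : HubbardFieldIdx L M) * (gen ℂ (((k₃', 1), 0) : HubbardFieldIdx L M) *
          gen ℂ (((k₄', 1), 1) : HubbardFieldIdx L M))) =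
      (if k₄ = k₃ then gen ℂ (((k₃', 1), 0) : HubbardFieldIdx L M) * gen ℂ (((k₄', 1), 1) : HubbardFieldIdx L M) else 0) +
        (if k₄' = k₃ then gen ℂ (((k₄, 1), 1) : HubbardFieldIdx L M) * gen ℂ (((k₃', 1), 0) : HubbardFieldIdx L M) else 0) := by
  simp only [grassmannDeriv_gen_mul, grassmannDeriv_gen]
  by_cases h : k₄ = k₃
  · subst h
    by_cases h' : k₄' = k₄
    · subst h'; simp
    · simp [h', Ne.symm h']
  · by_cases h' : k₄' = k₃
    · subst h'; simp [h, Ne.symm h]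
    · simp [h, Ne.symm h, h', Ne.symm h']

/-- **The spin-`↓` four-point function**: `∫ ψ̂⁺_{k₃}ψ̂⁻_{k₄}ψ̂⁺_{k₃'}ψ̂⁻_{k₄'} = (βL²)²(ĝ(k₃)ĝ(k₃')[k₄=k₃][k₄'=k₃'] − ĝ(k₃)ĝ(k₄)[k₄'=k₃][k₃'=k₄])`. -/
theorem gaussExpect_fourPoint_down {β : ℝ} (hβ : β ≠ 0) (μ : ℝ) (K : TrigPolyC4v) (k₃ k₄ k₃' k₄' : FreqMomentum L M) :
    gaussExpect ℂ (hubbardCovarianceCT L M β μ 0 K)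
        (gen ℂ (((k₃, 1), 0) : HubbardFieldIdx L M) * (gen ℂ (((k₄, 1), 1) : HubbardFieldIdx L M) *
          (gen ℂ (((k₃', 1), 0) : HubbardFieldIdx L M) * gen ℂ (((k₄', 1), 1) : HubbardFieldIdx L M)))) =
      (if k₄ = k₃ then (if k₄' = k₃' then
          ((β * (L : ℝ) ^ 2 : ℝ) : ℂ) ^ 2 * propCT L M β μ K k₃ * propCT L M β μ K k₃' else 0) else 0) -
        (if k₄' = k₃ then (if k₃' = k₄ then
          ((β * (L : ℝ) ^ 2 : ℝ) : ℂ) ^ 2 * propCT L M β μ K k₃ * propCT L M β μ K k₄ else 0) else 0) := by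
  rw [gaussExpect_psiPlus_mul hβ, grassmannDeriv_fourPoint_down, map_add, gaussExpect_ite, gaussExpect_ite,
    gaussExpect_psiPlus_psiMinus hβ, gaussExpect_psiMinus_psiPlus hβ]
  simp only [and_true]
  split_ifs <;> ring

/-- **The spin-`↑` six-point function**:
`∫ ψ̂⁻_{k₂↑}ψ̂⁺_{k₃↓}ψ̂⁻_{k₄↓} ψ̂⁺_{k₁'↑}ψ̂⁺_{k₃'↓}ψ̂⁻_{k₄'↓} = [k₁' = k₂] βL² ĝ(k₂) · (four-point function)`. -/
theorem gaussExpect_sixPoint_up {β : ℝ} (hβ : β ≠ 0) (μ : ℝ) (K : TrigPolyC4v) (k₂ k₃ k₄ k₁' k₃' k₄' : FreqMomentum L M) :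
    gaussExpect ℂ (hubbardCovarianceCT L M β μ 0 K)
        (gen ℂ (((k₂, 0), 1) : HubbardFieldIdx L M) * (gen ℂ (((k₃, 1), 0) : HubbardFieldIdx L M) *
          (gen ℂ (((k₄, 1), 1) : HubbardFieldIdx L M) * (gen ℂ (((k₁', 0), 0) : HubbardFieldIdx L M) *
            (gen ℂ (((k₃', 1), 0) : HubbardFieldIdx L M) * gen ℂ (((k₄', 1), 1) : HubbardFieldIdx L M)))))) =
      if k₁' = k₂ then
        ((β * (L : ℝ) ^ 2 : ℝ) : ℂ) * propCT L M β μ K k₂ *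
          ((if k₄ = k₃ then (if k₄' = k₃' then
              ((β * (L : ℝ) ^ 2 : ℝ) : ℂ) ^ 2 * propCT L M β μ K k₃ * propCT L M β μ K k₃' else 0) else 0) -
            (if k₄' = k₃ then (if k₃' = k₄ then
              ((β * (L : ℝ) ^ 2 : ℝ) : ℂ) ^ 2 * propCT L M β μ K k₃ * propCT L M β μ K k₄ else 0) else 0))
      else 0 := by
  rw [gaussExpect_psiMinus_mul hβ, grassmannDeriv_sixPoint_up, gaussExpect_ite, gaussExpect_fourPoint_down hβ]
  split_ifs <;> simp

/-- **`∫ ∂⁺_{k↑}W · ∂⁻_{k↑}W = (βL²)⁻⁶ · (βL²)³ · (Sun(k) − ĝ(k) T²)`** — the sunset (exchange pairing of the two spin-`↓` loops)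
and the one-particle-reducible double tadpole (direct pairing); `Sun(k) = Σ_{k+k₃=k₂+k₄} ĝ(k₂)ĝ(k₃)ĝ(k₄)`, `T = Σ_q ĝ(q)`. -/
theorem gaussExpect_dPlus_mul_dMinus_up {β : ℝ} (hβ : β ≠ 0) (μ : ℝ) (K : TrigPolyC4v) (k : FreqMomentum L M) :
    gaussExpect ℂ (hubbardCovarianceCT L M β μ 0 K)
        (grassmannDeriv ℂ (((k, 0), 0) : HubbardFieldIdx L M) (hubbardInteraction L M β 1) *
          grassmannDeriv ℂ (((k, 0), 1) : HubbardFieldIdx L M) (hubbardInteraction L M β 1)) =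
      (((1 / (β * (L : ℝ) ^ 2) ^ 3 : ℝ) : ℂ)) ^ 2 * (((β * (L : ℝ) ^ 2 : ℝ) : ℂ) ^ 3 *
        ((∑ k₂ : FreqMomentum L M, ∑ k₃ : FreqMomentum L M, ∑ k₄ : FreqMomentum L M,
            if matsubaraInt M k.1 + matsubaraInt M k₃.1 = matsubaraInt M k₂.1 + matsubaraInt M k₄.1 ∧ k.2 + k₃.2 = k₂.2 + k₄.2 then
              propCT L M β μ K k₂ * propCT L M β μ K k₃ * propCT L M β μ K k₄ else 0) -
          propCT L M β μ K k * (∑ q : FreqMomentum L M, propCT L M β μ K q) ^ 2)) := by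
  set c : ℂ := ((β * (L : ℝ) ^ 2 : ℝ) : ℂ) with hc
  set g : FreqMomentum L M → ℂ := propCT L M β μ K with hg
  -- the two guarded pairings of the four-point function
  set P : FreqMomentum L M → FreqMomentum L M → FreqMomentum L M → FreqMomentum L M → ℂ :=
    fun k₃ k₄ k₃' k₄' => if k₄ = k₃ then (if k₄' = k₃' then c ^ 2 * g k₃ * g k₃' else 0) else 0 with hP
  set Q : FreqMomentum L M → FreqMomentum L M → FreqMomentum L M → FreqMomentum L M → ℂ :=
    fun k₃ k₄ k₃' k₄' => if k₄' = k₃ then (if k₃' = k₄ then c ^ 2 * g k₃ * g k₄ else 0) else 0 with hQ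
  -- Step 1: expand into the six-fold guarded sum of six-point functions
  have h1 : gaussExpect ℂ (hubbardCovarianceCT L M β μ 0 K)
        (grassmannDeriv ℂ (((k, 0), 0) : HubbardFieldIdx L M) (hubbardInteraction L M β 1) *
          grassmannDeriv ℂ (((k, 0), 1) : HubbardFieldIdx L M) (hubbardInteraction L M β 1)) =
      (((1 / (β * (L : ℝ) ^ 2) ^ 3 : ℝ) : ℂ)) ^ 2 *
        ∑ k₂ : FreqMomentum L M, ∑ k₃ : FreqMomentum L M, ∑ k₄ : FreqMomentum L M,
          if matsubaraInt M k.1 + matsubaraInt M k₃.1 = matsubaraInt M k₂.1 + matsubaraInt M k₄.1 ∧ k.2 + k₃.2 = k₂.2 + k₄.2 then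
            ∑ k₁' : FreqMomentum L M, ∑ k₃' : FreqMomentum L M, ∑ k₄' : FreqMomentum L M,
              (if matsubaraInt M k₁'.1 + matsubaraInt M k₃'.1 = matsubaraInt M k.1 + matsubaraInt M k₄'.1 ∧
                  k₁'.2 + k₃'.2 = k.2 + k₄'.2 then
                -(if k₁' = k₂ then c * g k₂ * (P k₃ k₄ k₃' k₄' - Q k₃ k₄ k₃' k₄') else 0) else 0)
          else 0 := by
    rw [dPlus_up_hubbardInteraction, dMinus_up_hubbardInteraction, smul_mul_assoc, mul_smul_comm, map_smul, map_smul,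
      smul_eq_mul, smul_eq_mul, show ∀ x y : ℂ, x * (x * y) = x ^ 2 * y from fun x y => by ring]
    congr 1
    simp only [Finset.sum_mul, ite_mul, zero_mul]
    simp only [Finset.mul_sum, mul_ite, mul_zero, mul_neg]
    simp only [map_sum, gaussExpect_ite, map_neg]
    simp only [psiPlus, psiMinus, mul_assoc]
    simp only [gaussExpect_sixPoint_up hβ, hP, hQ, hc, hg, mul_assoc]
  -- Step 2: the `k₁'` sum collapses to `k₁' = k₂`
  have h2 : ∀ k₂ k₃ k₄ : FreqMomentum L M,
      (∑ k₁' : FreqMomentum L M, ∑ k₃' : FreqMomentum L M, ∑ k₄' : FreqMomentum L M,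
        if matsubaraInt M k₁'.1 + matsubaraInt M k₃'.1 = matsubaraInt M k.1 + matsubaraInt M k₄'.1 ∧ k₁'.2 + k₃'.2 = k.2 + k₄'.2 then
          -(if k₁' = k₂ then c * g k₂ * (P k₃ k₄ k₃' k₄' - Q k₃ k₄ k₃' k₄') else 0) else 0) =
      -(∑ k₃' : FreqMomentum L M, ∑ k₄' : FreqMomentum L M,
          if matsubaraInt M k₂.1 + matsubaraInt M k₃'.1 = matsubaraInt M k.1 + matsubaraInt M k₄'.1 ∧ k₂.2 + k₃'.2 = k.2 + k₄'.2 then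
            c * g k₂ * P k₃ k₄ k₃' k₄' else 0) +
        ∑ k₃' : FreqMomentum L M, ∑ k₄' : FreqMomentum L M,
          if matsubaraInt M k₂.1 + matsubaraInt M k₃'.1 = matsubaraInt M k.1 + matsubaraInt M k₄'.1 ∧ k₂.2 + k₃'.2 = k.2 + k₄'.2 then
            c * g k₂ * Q k₃ k₄ k₃' k₄' else 0 := by
    intro k₂ k₃ k₄
    rw [Finset.sum_eq_single k₂]
    · simp only [if_true]
      rw [← Finset.sum_neg_distrib, ← Finset.sum_add_distrib]
      refine Finset.sum_congr rfl fun k₃' _ => ?_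
      rw [← Finset.sum_neg_distrib, ← Finset.sum_add_distrib]
      refine Finset.sum_congr rfl fun k₄' _ => ?_
      split_ifs <;> ring
    · intro k₁' _ h
      exact Finset.sum_eq_zero fun k₃' _ => Finset.sum_eq_zero fun k₄' _ => by simp [h]
    · intro h; exact absurd (Finset.mem_univ _) h
  -- Step 3: the direct pairing `P` forces `k₄ = k₃`, `k₄' = k₃'`, and then `k₂ = k`
  have h3 : ∀ k₂ k₃ k₄ : FreqMomentum L M,
      (∑ k₃' : FreqMomentum L M, ∑ k₄' : FreqMomentum L M,
        if matsubaraInt M k₂.1 + matsubaraInt M k₃'.1 = matsubaraInt M k.1 + matsubaraInt M k₄'.1 ∧ k₂.2 + k₃'.2 = k.2 + k₄'.2 then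
          c * g k₂ * P k₃ k₄ k₃' k₄' else 0) =
      if k₄ = k₃ then (if k₂ = k then c ^ 3 * g k₂ * g k₃ * ∑ q : FreqMomentum L M, g q else 0) else 0 := by
    intro k₂ k₃ k₄
    by_cases h43 : k₄ = k₃
    · rw [if_pos h43]
      have hin : ∀ k₃' : FreqMomentum L M, (∑ k₄' : FreqMomentum L M,
          if matsubaraInt M k₂.1 + matsubaraInt M k₃'.1 = matsubaraInt M k.1 + matsubaraInt M k₄'.1 ∧ k₂.2 + k₃'.2 = k.2 + k₄'.2 then
            c * g k₂ * P k₃ k₄ k₃' k₄' else 0) =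
          if k₂ = k then c ^ 3 * g k₂ * g k₃ * g k₃' else 0 := by
        intro k₃'
        rw [Finset.sum_eq_single k₃']
        · simp only [hP, h43, if_true, vertexConstraint_cancel_right_iff k₂ k k₃']
          by_cases h2 : k₂ = k
          · subst h2; simp; ring
          · rw [if_neg (fun h => h2 h.symm), if_neg h2]
        · intro k₄' _ h; simp [hP, h]
        · intro h; exact absurd (Finset.mem_univ _) h
      simp only [hin]
      split_ifs
      · rw [Finset.mul_sum]
      · simp
    · rw [if_neg h43]
      exact Finset.sum_eq_zero fun k₃' _ => Finset.sum_eq_zero fun k₄' _ => by simp [hP, h43]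
  -- Step 4: the exchange pairing `Q` forces `k₃' = k₄`, `k₄' = k₃`; the second constraint is then the first
  have h4 : ∀ k₂ k₃ k₄ : FreqMomentum L M,
      (∑ k₃' : FreqMomentum L M, ∑ k₄' : FreqMomentum L M,
        if matsubaraInt M k₂.1 + matsubaraInt M k₃'.1 = matsubaraInt M k.1 + matsubaraInt M k₄'.1 ∧ k₂.2 + k₃'.2 = k.2 + k₄'.2 then
          c * g k₂ * Q k₃ k₄ k₃' k₄' else 0) =
      if matsubaraInt M k.1 + matsubaraInt M k₃.1 = matsubaraInt M k₂.1 + matsubaraInt M k₄.1 ∧ k.2 + k₃.2 = k₂.2 + k₄.2 then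
        c ^ 3 * g k₂ * g k₃ * g k₄ else 0 := by
    intro k₂ k₃ k₄
    rw [Finset.sum_eq_single k₄]
    · rw [Finset.sum_eq_single k₃]
      · simp only [hQ, if_true]
        have hiff : (matsubaraInt M k₂.1 + matsubaraInt M k₄.1 = matsubaraInt M k.1 + matsubaraInt M k₃.1 ∧ k₂.2 + k₄.2 = k.2 + k₃.2) ↔
            (matsubaraInt M k.1 + matsubaraInt M k₃.1 = matsubaraInt M k₂.1 + matsubaraInt M k₄.1 ∧ k.2 + k₃.2 = k₂.2 + k₄.2) :=
          ⟨fun h => ⟨h.1.symm, h.2.symm⟩, fun h => ⟨h.1.symm, h.2.symm⟩⟩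
        rw [if_congr hiff rfl rfl]
        split_ifs <;> ring
      · intro k₄' _ h; simp [hQ, h]
      · intro h; exact absurd (Finset.mem_univ _) h
    · intro k₃' _ h
      exact Finset.sum_eq_zero fun k₄' _ => by simp [hQ, h]
    · intro h; exact absurd (Finset.mem_univ _) h
  -- Step 5: the outer sums
  have h5 : (∑ k₂ : FreqMomentum L M, ∑ k₃ : FreqMomentum L M, ∑ k₄ : FreqMomentum L M,
      if matsubaraInt M k.1 + matsubaraInt M k₃.1 = matsubaraInt M k₂.1 + matsubaraInt M k₄.1 ∧ k.2 + k₃.2 = k₂.2 + k₄.2 then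
        (if k₄ = k₃ then (if k₂ = k then c ^ 3 * g k₂ * g k₃ * ∑ q : FreqMomentum L M, g q else 0) else 0) else 0) =
      c ^ 3 * g k * (∑ q : FreqMomentum L M, g q) ^ 2 := by
    rw [Finset.sum_eq_single k]
    · simp only [if_true]
      rw [pow_two, ← mul_assoc, Finset.mul_sum Finset.univ _ (c ^ 3 * g k), Finset.sum_mul]
      refine Finset.sum_congr rfl fun k₃ _ => ?_
      rw [Finset.sum_eq_single k₃]
      · rw [if_pos ⟨rfl, rfl⟩, if_pos rfl]
      · intro k₄ _ h; simp [h]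
      · intro h; exact absurd (Finset.mem_univ _) h
    · intro k₂ _ h
      exact Finset.sum_eq_zero fun k₃ _ => Finset.sum_eq_zero fun k₄ _ => by simp [h]
    · intro h; exact absurd (Finset.mem_univ _) h
  have h6 : (∑ k₂ : FreqMomentum L M, ∑ k₃ : FreqMomentum L M, ∑ k₄ : FreqMomentum L M,
      if matsubaraInt M k.1 + matsubaraInt M k₃.1 = matsubaraInt M k₂.1 + matsubaraInt M k₄.1 ∧ k.2 + k₃.2 = k₂.2 + k₄.2 then
        (if matsubaraInt M k.1 + matsubaraInt M k₃.1 = matsubaraInt M k₂.1 + matsubaraInt M k₄.1 ∧ k.2 + k₃.2 = k₂.2 + k₄.2 then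
          c ^ 3 * g k₂ * g k₃ * g k₄ else 0) else 0) =
      c ^ 3 * ∑ k₂ : FreqMomentum L M, ∑ k₃ : FreqMomentum L M, ∑ k₄ : FreqMomentum L M,
        if matsubaraInt M k.1 + matsubaraInt M k₃.1 = matsubaraInt M k₂.1 + matsubaraInt M k₄.1 ∧ k.2 + k₃.2 = k₂.2 + k₄.2 then
          g k₂ * g k₃ * g k₄ else 0 := by
    simp only [Finset.mul_sum]
    refine Finset.sum_congr rfl fun k₂ _ => Finset.sum_congr rfl fun k₃ _ => Finset.sum_congr rfl fun k₄ _ => ?_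
    split_ifs <;> ring
  -- assemble
  rw [h1]
  simp only [h2, h3, h4]
  congr 1
  have hsplit : ∀ k₂ k₃ k₄ : FreqMomentum L M,
      (if matsubaraInt M k.1 + matsubaraInt M k₃.1 = matsubaraInt M k₂.1 + matsubaraInt M k₄.1 ∧ k.2 + k₃.2 = k₂.2 + k₄.2 then
        -(if k₄ = k₃ then (if k₂ = k then c ^ 3 * g k₂ * g k₃ * ∑ q : FreqMomentum L M, g q else 0) else 0) +
          (if matsubaraInt M k.1 + matsubaraInt M k₃.1 = matsubaraInt M k₂.1 + matsubaraInt M k₄.1 ∧ k.2 + k₃.2 = k₂.2 + k₄.2 then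
            c ^ 3 * g k₂ * g k₃ * g k₄ else 0)
       else 0) =
      -(if matsubaraInt M k.1 + matsubaraInt M k₃.1 = matsubaraInt M k₂.1 + matsubaraInt M k₄.1 ∧ k.2 + k₃.2 = k₂.2 + k₄.2 then
          (if k₄ = k₃ then (if k₂ = k then c ^ 3 * g k₂ * g k₃ * ∑ q : FreqMomentum L M, g q else 0) else 0) else 0) +
        (if matsubaraInt M k.1 + matsubaraInt M k₃.1 = matsubaraInt M k₂.1 + matsubaraInt M k₄.1 ∧ k.2 + k₃.2 = k₂.2 + k₄.2 then
          (if matsubaraInt M k.1 + matsubaraInt M k₃.1 = matsubaraInt M k₂.1 + matsubaraInt M k₄.1 ∧ k.2 + k₃.2 = k₂.2 + k₄.2 then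
            c ^ 3 * g k₂ * g k₃ * g k₄ else 0) else 0) := by
    intro k₂ k₃ k₄
    split_ifs <;> ring
  simp only [hsplit, Finset.sum_add_distrib, Finset.sum_neg_distrib, h5, h6]
  ring

end Summit.HubbardSuperconductivity.HubbardSuperconductivity.Theorems.TwoPointAssembly

end
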